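import Literature.MathematicalPhysics.QuantumFieldTheory.OSTimeLorentzBoostGenerator
import Literature.Analysis.Distribution.SchwartzParameterIntegral
import Literature.Analysis.FunctionSpaces.SchwartzParametric
import Mathlib.Analysis.Normed.Module.FiniteDimension
import HarnessLib

/-!
# Exponentiating `T ∘ X_i = 0`: finite boost invariance of a tempered distribution

Topic `Literature/MathematicalPhysics/QuantumFieldTheory`; fourth file (everything proved) of the
position-space route to (B) `OS1973_lorentzInvariant_of_timeContinuation` of
`Literature.MathematicalPhysics.QuantumFieldTheory.OSTimeContinuation` (Osterwalder–Schrader I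
(1973), §4.2). `OSTimeLorentzBoostGenerator.apply_boostGen_eq_zero` gives `T(X_i G) = 0` for the
boost generator `X_i` and the time-ray boundary value `T` of an OS time continuation; this file
supplies the general **exponentiation step** `X_i`-invariance ⇒ invariance under the one-parameter
group of boosts `B_i(χ)`, for an arbitrary tempered distribution `T` on `(ℝ^{1+d})ⁿ`
(`apply_boostOrbit_eq`), with no differentiation of `𝓢`-valued maps:

* `boostOrbit i s F = F ∘ B_i(s)` (diagonal action), the group law `boostOrbit_boostOrbit`, the
  pointwise derivative `hasDerivAt_boostOrbit_apply` (`d/ds F(B_i(s) x) = (X_i F)(B_i(s) x)`), the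
  commutation `boostGen_boostOrbit` (`X_i (F ∘ B_i(s)) = (X_i F) ∘ B_i(s)`), and the continuity of
  `s ↦ H ∘ B_i(s)` in `𝓢` (`SchwartzParametric`);
* `apply_boostOrbit_eq` — if `T(X_i H) = 0` for all `H` then `T(F ∘ B_i(χ)) = T(F)`:
  `F ∘ B_i(χ) − F = ∫₀^χ (X_i F) ∘ B_i(s) ds` pointwise (fundamental theorem of calculus along the
  orbit) with a continuous `𝓢`-valued integrand, and tempered distributions commute with such
  parameter integrals (`SchwartzMap.clm_apply_eq_intervalIntegral`, `SchwartzParameterIntegral`), so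
  `T(F ∘ B_i(χ)) − T(F) = ∫₀^χ T(X_i (F ∘ B_i(s))) ds = 0`; negative `χ` by the group law.

Together with `apply_boostGen_eq_zero` this is the boost invariance of the OS boundary values,
OS I (4.14) integrated; the tree's `OSLorentzInvariantOfTimeContinuation` (landed concurrently,
by a bounded-derivative argument on regularised pairings) contains the discharge
`OS1973_lorentzInvariant_of_timeContinuation_holds` itself, which is therefore not repeated here.

## References

* K. Osterwalder, R. Schrader, *Axioms for Euclidean Green's functions*, Comm. Math. Phys. 31
  (1973) 83–112, §4.2, eq. (4.14). [OsterwalderSchraderCMP1973]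
-/

noncomputable section

open MeasureTheory Filter Set Metric Complex
open scoped Topology SchwartzMap LineDeriv ContDiff
open Literature.MathematicalPhysics.QuantumLattice Literature.Analysis.FunctionSpaces

namespace Literature.MathematicalPhysics.QuantumFieldTheory

variable {d n : ℕ}

/-! ### The orbit of a test function under the boosts -/

/-- **The boosted test function** `(F ∘ B_i(s))(x) = F(B_i(s) x₀, …, B_i(s) x_{n-1})`. [folklore] -/
def boostOrbit (i : Fin d) (s : ℝ) : 𝓢((Fin n → SpaceTime d), ℂ) →L[ℂ] 𝓢((Fin n → SpaceTime d), ℂ) :=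
  SchwartzMap.compCLMOfContinuousLinearEquiv ℂ (lorentzDiag n (boost i s))

/-- Values of the boosted test function. [folklore] -/
@[simp] theorem boostOrbit_apply (i : Fin d) (s : ℝ) (F : 𝓢((Fin n → SpaceTime d), ℂ))
    (x : Fin n → SpaceTime d) : boostOrbit i s F x = F fun k => boost i s (x k) := rfl

/-- Time component of a boosted vector. [folklore] -/
theorem boost_apply_zero (i : Fin d) (s : ℝ) (v : SpaceTime d) :
    boost i s v 0 = Real.cosh s * v 0 + Real.sinh s * v i.succ := by
  simp [boostLin_apply]

/-- `i`-th spatial component of a boosted vector. [folklore] -/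
theorem boost_apply_succ_self (i : Fin d) (s : ℝ) (v : SpaceTime d) :
    boost i s v i.succ = Real.sinh s * v 0 + Real.cosh s * v i.succ := by
  simp [boostLin_apply, Fin.succ_ne_zero]

/-- The other components are untouched. [folklore] -/
theorem boost_apply_of_ne (i : Fin d) (s : ℝ) (v : SpaceTime d) {j : Fin (d + 1)} (h0 : j ≠ 0)
    (hi : j ≠ i.succ) : boost i s v j = v j := by
  simp [boostLin_apply, h0, hi]

/-- Zero rapidity acts trivially (a private copy of the tree's `boost_zero_apply'`). [folklore] -/
private theorem boost_zero_apply (i : Fin d) (v : SpaceTime d) : boost i 0 v = v := by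
  ext j
  by_cases h0 : j = 0
  · subst h0; rw [boost_apply_zero]; simp
  · by_cases hi : j = i.succ
    · subst hi; rw [boost_apply_succ_self]; simp
    · rw [boost_apply_of_ne i 0 v h0 hi]

/-- The boost orbit at rapidity `0`. [folklore] -/
@[simp] theorem boostOrbit_zero_apply (i : Fin d) (F : 𝓢((Fin n → SpaceTime d), ℂ)) :
    boostOrbit i 0 F = F := by
  ext x
  simp only [boostOrbit_apply, boost_zero_apply]

/-- **Group law**: `(F ∘ B_i(b)) ∘ B_i(a) = F ∘ B_i(b + a)`. [folklore] -/
theorem boostOrbit_boostOrbit (i : Fin d) (a b : ℝ) (F : 𝓢((Fin n → SpaceTime d), ℂ)) :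
    boostOrbit i a (boostOrbit i b F) = boostOrbit i (b + a) F := by
  ext x
  simp only [boostOrbit_apply]
  congr 1
  funext k
  rw [boost_add_holds i b a, continuousLinearEquiv_mul_apply]

/-! ### Boosts on unit directions; the commutation `X_i (F ∘ B) = (X_i F) ∘ B` -/

/-- Components of unit directions: same coordinate. [folklore] -/
theorem unitDir_apply_same (k j : Fin n) (μ : Fin (d + 1)) :
    unitDir k μ j μ = if j = k then 1 else 0 := by
  rw [unitDir_apply]; simp

/-- Components of unit directions: other coordinates vanish. [folklore] -/
theorem unitDir_apply_of_ne (k j : Fin n) {μ ν : Fin (d + 1)} (h : ν ≠ μ) : unitDir k μ j ν = 0 := by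
  rw [unitDir_apply]; simp [h]

/-- `B_i(s) e_{0,k} = cosh s · e_{0,k} + sinh s · e_{i,k}`. [folklore] -/
theorem lorentzDiag_boost_unitDir_zero (i : Fin d) (s : ℝ) (k : Fin n) :
    lorentzDiag n (boost i s) (unitDir k (0 : Fin (d + 1))) =
      Real.cosh s • unitDir k (0 : Fin (d + 1)) + Real.sinh s • unitDir k i.succ := by
  have hne : (i.succ : Fin (d + 1)) ≠ 0 := Fin.succ_ne_zero i
  funext j; ext μ
  simp only [lorentzDiag_apply, Pi.add_apply, Pi.smul_apply, PiLp.add_apply, PiLp.smul_apply,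
    smul_eq_mul]
  by_cases h0 : μ = 0
  · subst h0
    rw [boost_apply_zero, unitDir_apply_same, unitDir_apply_of_ne k j hne, unitDir_apply_of_ne k j hne.symm]
  · by_cases hi : μ = i.succ
    · subst hi
      rw [boost_apply_succ_self, unitDir_apply_same, unitDir_apply_same, unitDir_apply_of_ne k j hne]
      ring
    · rw [boost_apply_of_ne i s _ h0 hi, unitDir_apply_of_ne k j h0, unitDir_apply_of_ne k j hi]
      ring

/-- `B_i(s) e_{i,k} = sinh s · e_{0,k} + cosh s · e_{i,k}`. [folklore] -/
theorem lorentzDiag_boost_unitDir_succ (i : Fin d) (s : ℝ) (k : Fin n) :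
    lorentzDiag n (boost i s) (unitDir k i.succ) =
      Real.sinh s • unitDir k (0 : Fin (d + 1)) + Real.cosh s • unitDir k i.succ := by
  have hne : (i.succ : Fin (d + 1)) ≠ 0 := Fin.succ_ne_zero i
  funext j; ext μ
  simp only [lorentzDiag_apply, Pi.add_apply, Pi.smul_apply, PiLp.add_apply, PiLp.smul_apply,
    smul_eq_mul]
  by_cases h0 : μ = 0
  · subst h0
    rw [boost_apply_zero, unitDir_apply_same, unitDir_apply_same, unitDir_apply_of_ne k j hne.symm]
    ring
  · by_cases hi : μ = i.succ
    · subst hi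
      rw [boost_apply_succ_self, unitDir_apply_same, unitDir_apply_of_ne k j hne.symm,
        unitDir_apply_of_ne k j hne]
    · rw [boost_apply_of_ne i s _ h0 hi, unitDir_apply_of_ne k j hi, unitDir_apply_of_ne k j h0]
      ring

/-- **The boost generator commutes with the boosts it generates**:
`X_i (F ∘ B_i(s)) = (X_i F) ∘ B_i(s)`. [folklore] -/
theorem boostGen_boostOrbit (i : Fin d) (s : ℝ) (F : 𝓢((Fin n → SpaceTime d), ℂ)) :
    boostGen i (boostOrbit i s F) = boostOrbit i s (boostGen i F) := by
  ext x
  rw [boostGen_apply, boostOrbit_apply, boostGen_apply]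
  have hd : ∀ v : Fin n → SpaceTime d, ∂_{v} (boostOrbit i s F) x =
      ∂_{lorentzDiag n (boost i s) v} F (fun k => boost i s (x k)) := by
    intro v
    rw [boostOrbit, SchwartzMap.lineDerivOp_compCLMOfContinuousLinearEquiv]
    rfl
  simp only [hd, lorentzDiag_boost_unitDir_zero, lorentzDiag_boost_unitDir_succ,
    LineDerivAdd.lineDerivOp_left_add, LineDerivLeftSMul.lineDerivOp_left_smul, add_apply, smul_apply,
    Complex.real_smul, boost_apply_zero, boost_apply_succ_self]
  refine Finset.sum_congr rfl fun k _ => ?_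
  push_cast
  ring

/-! ### The derivative of the orbit and the fundamental theorem of calculus -/

/-- The velocity of the boost orbit of a configuration: `d/ds B_i(s) x`. [folklore] -/
def boostCurveDeriv (i : Fin d) (x : Fin n → SpaceTime d) (s : ℝ) : Fin n → SpaceTime d :=
  fun k => WithLp.toLp 2 fun j =>
    if j = 0 then Real.sinh s * x k 0 + Real.cosh s * x k i.succ
    else if j = i.succ then Real.cosh s * x k 0 + Real.sinh s * x k i.succ else 0

/-- `s ↦ B_i(s) x` is differentiable with derivative `boostCurveDeriv i x s`. [folklore] -/
theorem hasDerivAt_boost_diag (i : Fin d) (x : Fin n → SpaceTime d) (s : ℝ) :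
    HasDerivAt (fun σ : ℝ => fun k => boost i σ (x k)) (boostCurveDeriv i x s) s := by
  refine hasDerivAt_pi.2 fun k => ?_
  set raw : ℝ → Fin (d + 1) → ℝ := fun σ j =>
      if j = 0 then Real.cosh σ * x k 0 + Real.sinh σ * x k i.succ
      else if j = i.succ then Real.sinh σ * x k 0 + Real.cosh σ * x k i.succ else x k j with hraw_def
  set raw' : Fin (d + 1) → ℝ := fun j => if j = 0 then Real.sinh s * x k 0 + Real.cosh s * x k i.succ
      else if j = i.succ then Real.cosh s * x k 0 + Real.sinh s * x k i.succ else 0 with hraw'_def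
  have hraw : HasDerivAt raw raw' s := by
    refine hasDerivAt_pi.2 fun j => ?_
    by_cases hj : j = 0
    · subst hj
      simp only [hraw_def, hraw'_def, if_true]
      exact ((Real.hasDerivAt_cosh s).mul_const (x k 0)).add ((Real.hasDerivAt_sinh s).mul_const (x k i.succ))
        |>.congr_of_eventuallyEq (Eventually.of_forall fun y => rfl)
    · by_cases hji : j = i.succ
      · subst hji
        simp only [hraw_def, hraw'_def, Fin.succ_ne_zero, if_false, if_true]
        exact ((Real.hasDerivAt_sinh s).mul_const (x k 0)).add ((Real.hasDerivAt_cosh s).mul_const (x k i.succ))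
          |>.congr_of_eventuallyEq (Eventually.of_forall fun y => rfl)
      · simp only [hraw_def, hraw'_def, hj, hji, if_false]
        exact hasDerivAt_const _ _
  set L : (Fin (d + 1) → ℝ) →L[ℝ] EuclideanSpace ℝ (Fin (d + 1)) :=
    ((PiLp.continuousLinearEquiv 2 ℝ (fun _ : Fin (d + 1) => ℝ)).symm :
      (Fin (d + 1) → ℝ) →L[ℝ] EuclideanSpace ℝ (Fin (d + 1))) with hL
  have hLapp : ∀ (f : Fin (d + 1) → ℝ) (j : Fin (d + 1)), (L f) j = f j := fun f j => rfl
  have hcomp := L.hasFDerivAt.comp_hasDerivAt s hraw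
  have hfun : (fun σ : ℝ => boost i σ (x k)) = L ∘ raw := by
    funext σ
    ext j
    rw [Function.comp_apply, hLapp]
    simp only [hraw_def, boost_apply, boostLin_apply]
  have hder : boostCurveDeriv i x s k = L raw' := by
    ext j
    rw [hLapp]
    rfl
  rw [hfun, hder]
  exact hcomp

/-- The velocity in terms of the boosted configuration `y = B_i(s) x`:
`d/ds B_i(s) x = ∑ₖ (yⁱ_k e_{0,k} + y⁰_k e_{i,k})`. [folklore] -/
theorem boostCurveDeriv_eq (i : Fin d) (x : Fin n → SpaceTime d) (s : ℝ) :
    boostCurveDeriv i x s = ∑ k, ((boost i s (x k) i.succ) • unitDir k (0 : Fin (d + 1)) +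
      (boost i s (x k) 0) • unitDir k i.succ) := by
  funext j; ext ν
  simp only [boostCurveDeriv, Finset.sum_apply, Pi.add_apply, Pi.smul_apply, WithLp.ofLp_sum,
    WithLp.ofLp_add, WithLp.ofLp_smul, smul_eq_mul, unitDir_apply, boost_apply_zero,
    boost_apply_succ_self]
  by_cases hν : ν = 0
  · subst hν
    simp [(Fin.succ_ne_zero i).symm]
  · by_cases hνi : ν = i.succ
    · subst hνi
      simp [Fin.succ_ne_zero]
    · simp [hν, hνi]

/-- **The derivative of the boost orbit of a test function**:
`d/ds F(B_i(s) x) = (X_i F)(B_i(s) x)`. [folklore] -/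
theorem hasDerivAt_boostOrbit_apply (i : Fin d) (F : 𝓢((Fin n → SpaceTime d), ℂ))
    (x : Fin n → SpaceTime d) (s : ℝ) :
    HasDerivAt (fun σ : ℝ => boostOrbit i σ F x) (boostOrbit i s (boostGen i F) x) s := by
  have h := (F.hasFDerivAt _).comp_hasDerivAt s (hasDerivAt_boost_diag i x s)
  have hval : fderiv ℝ (F : (Fin n → SpaceTime d) → ℂ) (fun k => boost i s (x k)) (boostCurveDeriv i x s) =
      boostOrbit i s (boostGen i F) x := by
    rw [boostCurveDeriv_eq, map_sum, boostOrbit_apply, boostGen_apply]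
    refine Finset.sum_congr rfl fun k _ => ?_
    rw [map_add, map_smul, map_smul]
    simp only [SchwartzMap.lineDerivOp_apply_eq_fderiv, Complex.real_smul]
    ring
  rw [← hval]
  exact h.congr_of_eventuallyEq (Eventually.of_forall fun σ => rfl)

/-- `s ↦ (X_i F)(B_i(s) x)` is continuous. [folklore] -/
theorem continuous_boostOrbit_apply (i : Fin d) (H : 𝓢((Fin n → SpaceTime d), ℂ))
    (x : Fin n → SpaceTime d) : Continuous fun s : ℝ => boostOrbit i s H x := by
  simp only [boostOrbit_apply]
  exact H.continuous.comp (continuous_pi fun k => (hasDerivAt_boost_diag i x ·) |>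
    fun h => continuous_iff_continuousAt.2 fun s => ((h s).continuousAt.comp continuousAt_id) |>
      fun hc => (continuous_apply k).continuousAt.comp hc)

/-- **Fundamental theorem of calculus along the orbit**:
`F(B_i(χ) x) − F(x) = ∫₀^χ (X_i F)(B_i(s) x) ds`. [folklore] -/
theorem boostOrbit_apply_sub (i : Fin d) (F : 𝓢((Fin n → SpaceTime d), ℂ))
    (x : Fin n → SpaceTime d) (χ : ℝ) :
    boostOrbit i χ F x - F x = ∫ s in (0 : ℝ)..χ, boostOrbit i s (boostGen i F) x := by
  have h := intervalIntegral.integral_eq_sub_of_hasDerivAt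
    (fun s _ => hasDerivAt_boostOrbit_apply i F x s)
    ((continuous_boostOrbit_apply i (boostGen i F) x).intervalIntegrable 0 χ)
  rw [h]
  simp

/-! ### Continuity of the orbit in the Schwartz topology -/

/-- `s ↦ B_i(s)` acting diagonally is continuous in operator norm. [folklore] -/
theorem continuous_lorentzDiag_boost (i : Fin d) :
    Continuous fun s : ℝ => (lorentzDiag n (boost i s) : (Fin n → SpaceTime d) →L[ℝ] (Fin n → SpaceTime d)) := by
  refine continuous_clm_apply.2 fun y => ?_
  have h : ∀ s : ℝ, (lorentzDiag n (boost i s) : (Fin n → SpaceTime d) →L[ℝ] (Fin n → SpaceTime d)) y =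
      fun k => boost i s (y k) := fun s => rfl
  simp only [h]
  exact continuous_iff_continuousAt.2 fun s =>
    (hasDerivAt_boost_diag i y s).continuousAt

/-- `s ↦ H ∘ B_i(s)` is continuous `ℝ → 𝓢`. [folklore] -/
theorem continuous_boostOrbit (i : Fin d) (H : 𝓢((Fin n → SpaceTime d), ℂ)) :
    Continuous fun s : ℝ => boostOrbit i s H :=
  SchwartzMap.continuous_compCLMOfContinuousLinearEquiv_apply ℂ (fun s : ℝ => lorentzDiag n (boost i s))
    (continuous_lorentzDiag_boost i) H

/-! ### Finite boost invariance from `T ∘ X_i = 0` -/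

/-- **Infinitesimal invariance integrates to finite boost invariance**: if a tempered distribution
`T` satisfies `T(X_i H) = 0` for all `H` then `T(F ∘ B_i(χ)) = T(F)` for all `χ`. Proof:
`F ∘ B_i(χ) − F = ∫₀^χ (X_i F) ∘ B_i(s) ds` pointwise with a continuous `𝓢`-valued integrand, so
`T(F ∘ B_i(χ)) − T(F) = ∫₀^χ T((X_i F) ∘ B_i(s)) ds = ∫₀^χ T(X_i (F ∘ B_i(s))) ds = 0`
(tempered distributions commute with parameter integrals in `𝓢`,
`SchwartzMap.clm_apply_eq_intervalIntegral`); negative `χ` by the group law. [folklore] -/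
theorem apply_boostOrbit_eq (T : 𝓢((Fin n → SpaceTime d), ℂ) →L[ℂ] ℂ) (i : Fin d)
    (hT : ∀ H : 𝓢((Fin n → SpaceTime d), ℂ), T (boostGen i H) = 0)
    (χ : ℝ) (F : 𝓢((Fin n → SpaceTime d), ℂ)) : T (boostOrbit i χ F) = T F := by
  have key : ∀ χ : ℝ, 0 ≤ χ → ∀ F : 𝓢((Fin n → SpaceTime d), ℂ), T (boostOrbit i χ F) = T F := by
    intro χ hχ F
    set Φ : ℝ → 𝓢((Fin n → SpaceTime d), ℂ) := fun s => boostOrbit i s (boostGen i F) with hΦ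
    have hΦc : Continuous Φ := continuous_boostOrbit i (boostGen i F)
    have hΨ : ∀ x, (boostOrbit i χ F - F) x = ∫ s in (0 : ℝ)..χ, Φ s x := fun x => by
      rw [sub_apply]
      exact boostOrbit_apply_sub i F x χ
    have h := SchwartzMap.clm_apply_eq_intervalIntegral hΦc hχ hΨ (T.restrictScalars ℝ)
    simp only [ContinuousLinearMap.coe_restrictScalars', map_sub, hΦ] at h
    have h0 : ∀ s : ℝ, T (boostOrbit i s (boostGen i F)) = 0 := fun s => by
      rw [← boostGen_boostOrbit]; exact hT _
    simp only [h0, intervalIntegral.integral_zero] at h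
    exact sub_eq_zero.1 h
  rcases le_or_gt 0 χ with hχ | hχ
  · exact key χ hχ F
  · have h := key (-χ) (by linarith) (boostOrbit i χ F)
    rw [boostOrbit_boostOrbit, add_neg_cancel, boostOrbit_zero_apply] at h
    exact h.symm

end Literature.MathematicalPhysics.QuantumFieldTheory
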